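import Summits.Ventures.CertifiedArithmetic.Expansions.Orient2dEstimate
import Mathlib.Tactic.Linarith
import Mathlib.Tactic.Positivity
import Mathlib.Tactic.Ring
import Mathlib.Tactic.NormNum

/-!
# APPROXIMATE is exact to its own last bit

HONEST FRAMING. New work of this programme (Ventures), not a published result: the statements
below are ours; Shewchuk's paper supplies only the objects (`estimate` = APPROXIMATE /
`predicates.c`'s `estimate()`, nonoverlapping expansions, the "`c`-below" gap relation `Below`,
`RoundoffBelow`). Machine-checked below; the numerical evidence that preceded the proof is
recorded at the end of this docstring.

THE RESULT. Let `l` be a nonoverlapping expansion of floats of `F(p, emin)` (smallest component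
first, zeros allowed — `IsExpansion 1 l`, Shewchuk's input contract) and `Q = estimate fl l` its
one-word approximation, the left fold `Q ⇐ Q ⊕ x`. Write `2^v` for the least significant nonzero
bit of `Q` (`Q = M·2^v`, `M` odd). Then

* for ANY round-to-nearest `fl` (`p ≥ 1`, gradual underflow included): `Q − Σ l` lies 1-below
  `Q`, i.e. `|Q − Σ| < 2^v` — the computed word and its own error are NONOVERLAPPING
  (`below_one_estimate_sub_sum`, `abs_estimate_sub_sum_lt_lowbit`);
* for ROUND-TO-EVEN (`p ≥ 1`): `Q − Σ l` lies 2-below `Q`, i.e. `|Q − Σ| < 2^v / 2` — the word and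
  its error are NONADJACENT; equivalently **`Q` is the unique point of its own quantum grid
  `2^v·ℤ` nearest to the true sum** (`below_two_estimate_sub_sum_roundTiesEven`,
  `estimate_nearest_on_own_grid`): every bit APPROXIMATE returns is a bit of a correct rounding
  of `Σ` to the position of its last nonzero bit;
* uniformly: `RoundoffBelow 2^j fl` with `j ≤ p` gives `Below 2^j (Q − Σ) Q`
  (`below_estimate_sub_sum`).

The factor two is a property of the tie rule, not of nearest rounding:
`exists_isRoundNearest_not_below_two` exhibits a round-to-nearest of `F(2, 0)` taking the
midpoint `7` to `6` (ties toward zero there) for which `l = [1, 6]` gives `Q = 6 = 3·2^1`,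
`Σ = 7`, `|Q − Σ| = 2^v/2`.

MECHANISM (one induction along the fold; `E = Q − Σ(prefix)`, next component `x`, `t = Q + x`).
Three grids. (i) `E` lies `2^j`-below `Q` (induction) and `2^j`-below `x`: the components before
`x` are `< 2^w` for the quantum `2^w` of `x`, so their accumulated error is `< u·2^w` and
`2^j·u ≤ 1`; hence with `2^g` the common quantum of `Q` and `x`: `t ∈ 2^g·ℤ` and `2^j|E| < 2^g`.
(ii) If `t` is a float nothing happens. (iii) Otherwise the roundoff `δ = fl t − t` is a NONZERO
multiple of `2^g` with `2^j|δ| < 2^s` for a quantum `2^s` of `fl t` (`RoundoffBelow`); this forces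
`g + j < s`, so `2^j·δ` and `2^s` are both multiples of `2^(g+j)` and `2^j|δ| ≤ 2^s − 2^(g+j)` —
the discreteness of the roundoff leaves exactly the room `2^(g+j) ≥ 2^g > 2^j|E|` that the old
error needs: `2^j|δ + E| < 2^s` (`two_pow_mul_abs_add_lt_of_onGrid`). The magnitude bookkeeping
(`|Q| ≤ 2^b`, `|E| < u·2^b` when all components are `< 2^b`) rides along in the same induction
(`estimate_lastBit_invariant`).

EVIDENCE BEFORE PROOF (exhaustive enumeration, integers scaled so the first component is odd,
all sign patterns): over every nonoverlapping list with components `< 2^14` and `n ≤ 8`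
components, round-to-even gives `max |Q − Σ|/2^v = 0.3333 (p = 1), 0.4285 (p = 2),
0.4663 (p = 3), 0.4834 (p = 4)`, never `≥ 1/2`; over components `< 2^12`, `n ≤ 7`, `p ≤ 3`, an
adversary choosing every tie reaches `63/64` (`p = 1`: `[-1, -2, -4, …, -64] ↦ Q = -64`,
`Σ = -127`), never `≥ 1`.

References: J. R. Shewchuk, Discrete Comput. Geom. 18 (1997) 305–363: §2.1 (nonoverlapping /
nonadjacent, round-to-even Cor. 9), §2.7 APPROXIMATE, `predicates.c` `estimate()` [Shewchuk1997].
-/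

namespace Summit.Ventures.CertifiedArithmetic.Expansions

open Literature.ComputerArithmetic.JeannerodRump2018
open Literature.ComputerArithmetic.BoldoJeannerodMelquiondMuller2023 hiding twoSum twoSum_fst
  isFloat_twoSum
open Literature.ComputerArithmetic.JoldesMullerPopescu2017 (isFloat_two_zpow abs_fl_le_of_abs_le)
open Literature.ComputerArithmetic.JeannerodMullerZimmermann2018
  (abs_sub_fl_le_half_zpow_of_abs_le)
open Literature.ComputerArithmetic.Shewchuk1997

variable {p : ℕ} {emin : ℤ} {fl : ℚ → ℚ}

/-! ## Two lemmas: the grid step and the size of one roundoff -/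

/-- **The grid step.** If `Q'` lies on the grid `2^s`, `t` on the grid `2^g`, the roundoff
`Q' − t` is nonzero with `2^j|Q' − t| < 2^s`, and `2^j|E| < 2^g`, then `2^j|Q' − t + E| < 2^s`:
the roundoff is a nonzero multiple of `2^g`, which forces `g + j < s` and
`2^j|Q' − t| ≤ 2^s − 2^(g+j)`, leaving room `2^(g+j) ≥ 2^g` for `E`. -/
theorem two_pow_mul_abs_add_lt_of_onGrid {j : ℕ} {g s : ℤ} {Q' t E : ℚ} (hQ : OnGrid s Q')
    (ht : OnGrid g t) (hne : Q' - t ≠ 0) (hδ : (2 : ℚ) ^ j * |Q' - t| < (2 : ℚ) ^ s)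
    (hE : (2 : ℚ) ^ j * |E| < (2 : ℚ) ^ g) :
    (2 : ℚ) ^ j * |Q' - t + E| < (2 : ℚ) ^ s := by
  have h2ne : (2 : ℚ) ≠ 0 := by norm_num
  have hj : (0 : ℚ) < (2 : ℚ) ^ j := by positivity
  have h1j : (1 : ℚ) ≤ (2 : ℚ) ^ j := one_le_pow₀ (by norm_num)
  have hself : |Q' - t| ≤ (2 : ℚ) ^ j * |Q' - t| := le_mul_of_one_le_left (abs_nonneg _) h1j
  rcases lt_or_ge s g with hsg | hgs
  · -- `s < g`: the roundoff would be a nonzero multiple of `2^s` smaller than `2^s`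
    have h1 : (2 : ℚ) ^ s ≤ |Q' - t| := (hQ.sub (ht.mono hsg.le)).two_zpow_le_abs hne
    linarith
  · have hd : OnGrid g (Q' - t) := (hQ.mono hgs).sub ht
    have h1 : (2 : ℚ) ^ g ≤ |Q' - t| := hd.two_zpow_le_abs hne
    have hgj : (2 : ℚ) ^ (g + j) ≤ (2 : ℚ) ^ j * |Q' - t| := by
      rw [zpow_add₀ h2ne, zpow_natCast, mul_comm]
      exact mul_le_mul_of_nonneg_left h1 hj.le
    have hlt : g + j < s := by
      by_contra hle
      rw [not_lt] at hle
      have : (2 : ℚ) ^ s ≤ (2 : ℚ) ^ (g + j) := zpow_le_zpow_right₀ (by norm_num) hle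
      linarith
    -- `2^j (Q' - t)` and `2^s` are multiples of `2^(g+j)`
    have hA : OnGrid (g + j) ((2 : ℚ) ^ j * |Q' - t|) := by
      obtain ⟨d, hd'⟩ := hd.abs
      exact ⟨d, by rw [hd', zpow_add₀ h2ne, zpow_natCast]; ring⟩
    have hle : (2 : ℚ) ^ j * |Q' - t| + (2 : ℚ) ^ (g + j) ≤ (2 : ℚ) ^ s :=
      hA.add_two_zpow_le (OnGrid.two_zpow hlt.le) hδ
    have hgle : (2 : ℚ) ^ g ≤ (2 : ℚ) ^ (g + j) := zpow_le_zpow_right₀ (by norm_num) (by omega)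
    calc (2 : ℚ) ^ j * |Q' - t + E| ≤ (2 : ℚ) ^ j * (|Q' - t| + |E|) :=
          mul_le_mul_of_nonneg_left (abs_add_le _ _) hj.le
      _ = (2 : ℚ) ^ j * |Q' - t| + (2 : ℚ) ^ j * |E| := by ring
      _ < (2 : ℚ) ^ s := by linarith

/-- **One roundoff.** Rounding a multiple of `2^emin` of magnitude at most `2^b` errs by at most
`2^(b-p)/2`: below `2^(emin+p)` such a number is itself a float, above it half an ulp is that. -/
theorem two_mul_abs_fl_sub_le_of_onGrid (hp : 1 ≤ p) (hfl : IsRoundNearest p emin fl) {t : ℚ}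
    (ht : OnGrid emin t) {b : ℤ} (hb : |t| ≤ (2 : ℚ) ^ b) :
    2 * |fl t - t| ≤ (2 : ℚ) ^ (b - p) := by
  have h2ne : (2 : ℚ) ≠ 0 := by norm_num
  have hpb : (2 : ℚ) ^ p * (2 : ℚ) ^ (b - p) = (2 : ℚ) ^ b := by
    rw [← zpow_natCast, ← zpow_add₀ h2ne]; congr 1; ring
  rcases le_or_gt emin (b - p) with h | h
  · have hb' : |t| ≤ (2 : ℚ) ^ p * (2 : ℚ) ^ (b - p) := by rw [hpb]; exact hb
    have := abs_sub_fl_le_half_zpow_of_abs_le hp hfl h hb'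
    rw [abs_sub_comm] at this
    linarith
  · -- `b - p < emin`: `t = N·2^emin` with `|N| ≤ 2^p` is a float, the roundoff vanishes
    obtain ⟨N, hN⟩ := ht
    have h2e : (0 : ℚ) < (2 : ℚ) ^ emin := zpow_pos (by norm_num) _
    have hNp : |N| ≤ 2 ^ p := by
      have h1 : |(N : ℚ)| * (2 : ℚ) ^ emin ≤ (2 : ℚ) ^ b := by
        rw [hN, abs_mul, abs_of_pos h2e] at hb; exact hb
      have h2 : (2 : ℚ) ^ b ≤ (2 : ℚ) ^ p * (2 : ℚ) ^ emin := by
        rw [← zpow_natCast, ← zpow_add₀ h2ne]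
        exact zpow_le_zpow_right₀ (by norm_num) (by omega)
      have h3 : |(N : ℚ)| ≤ (2 : ℚ) ^ p := le_of_mul_le_mul_right (h1.trans h2) h2e
      rw [← Int.cast_abs] at h3
      exact_mod_cast h3
    have hF : IsFloat p emin t := by rw [hN]; exact isFloat_of_abs_le hp hNp le_rfl
    rw [fl_eq_self hfl hF, sub_self, abs_zero, mul_zero]
    exact zpow_nonneg (by norm_num) _

/-! ## The invariant of the fold -/

/-- **THE INVARIANT OF APPROXIMATE** on a nonoverlapping expansion of floats, for a round-to-nearest
with `RoundoffBelow 2^j` (`j ≤ p`; `j = 0` is every round-to-nearest, `j = 1` round-to-even):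
the running word `Q` is a float, its error `Q − Σ` lies `2^j`-below `Q`, and if every component is
`< 2^b` in magnitude then `|Q| ≤ 2^b` and `|Q − Σ| < u·2^b = 2^(b-p)`. -/
theorem estimate_lastBit_invariant (hp : 1 ≤ p) (hfl : IsRoundNearest p emin fl) {j : ℕ}
    (hjp : j ≤ p) (hflj : RoundoffBelow ((2 : ℚ) ^ j) fl) :
    ∀ {l : List ℚ}, (∀ x ∈ l, IsFloat p emin x) → IsExpansion 1 l →
      IsFloat p emin (estimate fl l) ∧
        Below ((2 : ℚ) ^ j) (estimate fl l - l.sum) (estimate fl l) ∧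
        ∀ b : ℤ, (∀ x ∈ l, |x| < (2 : ℚ) ^ b) →
          |estimate fl l| ≤ (2 : ℚ) ^ b ∧ |estimate fl l - l.sum| < (2 : ℚ) ^ (b - p) := by
  have h2ne : (2 : ℚ) ≠ 0 := by norm_num
  intro l
  induction l using List.reverseRecOn with
  | nil =>
    intro _ _
    rw [show estimate fl [] = 0 from rfl, List.sum_nil, sub_zero]
    refine ⟨⟨0, emin, by simp, le_rfl, by simp⟩, below_zero_right _ _, fun b _ => ⟨?_, ?_⟩⟩
    · rw [abs_zero]; exact zpow_nonneg (by norm_num) _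
    · rw [abs_zero]; exact zpow_pos (by norm_num) _
  | append_singleton l a ih =>
    intro hF hE
    have hFl : ∀ x ∈ l, IsFloat p emin x := fun x hx => hF x (by simp [hx])
    have hFa : IsFloat p emin a := hF a (by simp)
    have hEl : IsExpansion 1 l := (List.pairwise_append.mp hE).1
    have hbelow : ∀ x ∈ l, Below 1 x a := fun x hx =>
      (List.pairwise_append.mp hE).2.2 x hx a (by simp)
    obtain ⟨hQF, hQB, hQM⟩ := ih hFl hEl
    rw [List.sum_append, List.sum_singleton]
    by_cases hl : l = []
    · subst hl
      rw [show estimate fl ([] ++ [a]) = a from rfl, List.sum_nil, zero_add, sub_self]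
      refine ⟨hFa, below_zero_left hFa _, fun b hb => ⟨(hb a (by simp)).le, ?_⟩⟩
      rw [abs_zero]; exact zpow_pos (by norm_num) _
    have hstep : estimate fl (l ++ [a]) = fl (estimate fl l + a) := by
      obtain ⟨e, es, rfl⟩ := List.exists_cons_of_ne_nil hl
      simp [estimate, List.foldl_append]
    rw [hstep]
    set Q := estimate fl l with hQdef
    by_cases ha0 : a = 0
    · rw [ha0, add_zero, add_zero, fl_eq_self hfl hQF]
      exact ⟨hQF, hQB, fun b hb => hQM b fun x hx => hb x (by simp [hx])⟩
    obtain ⟨M, v, hMo, -, hv, hav⟩ := exists_odd_mul_two_zpow hFa ha0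
    have h2v : (0 : ℚ) < (2 : ℚ) ^ v := zpow_pos (by norm_num) _
    have haG : OnGrid v a := ⟨M, hav⟩
    -- every earlier component lies below the quantum `2^v` of `a`
    have hlv : ∀ x ∈ l, |x| < (2 : ℚ) ^ v := fun x hx => by
      obtain ⟨s', hs', hxs'⟩ := hbelow x hx
      rw [one_mul] at hxs'
      rw [hav] at hs'
      exact lt_of_lt_of_le hxs' (zpow_le_zpow_right₀ (by norm_num) (OnGrid.le_of_odd hMo hs'))
    obtain ⟨hQv, hEv⟩ := hQM v hlv
    set t := Q + a with htdef
    -- (i) the old error lies `2^j`-below `a` as well: `2^j |E| < 2^j · 2^(v-p) ≤ 2^v`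
    have hjv : (2 : ℚ) ^ j * (2 : ℚ) ^ (v - p) ≤ (2 : ℚ) ^ v := by
      rw [← zpow_natCast, ← zpow_add₀ h2ne]
      exact zpow_le_zpow_right₀ (by norm_num) (by omega)
    have hjE : (2 : ℚ) ^ j * |Q - l.sum| < (2 : ℚ) ^ v :=
      lt_of_lt_of_le (mul_lt_mul_of_pos_left hEv (by positivity)) hjv
    have hsplit : fl t - (l.sum + a) = fl t - t + (Q - l.sum) := by rw [htdef]; ring
    -- conjunct 2: the new error lies `2^j`-below the new word
    have hB : Below ((2 : ℚ) ^ j) (fl t - (l.sum + a)) (fl t) := by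
      obtain ⟨s₀, hs₀, hE₀⟩ := hQB
      have htg : OnGrid (min s₀ v) t :=
        (hs₀.mono (min_le_left _ _)).add (haG.mono (min_le_right _ _))
      have hEg : (2 : ℚ) ^ j * |Q - l.sum| < (2 : ℚ) ^ (min s₀ v) := by
        rcases min_choice s₀ v with h | h <;> rw [h] <;> assumption
      by_cases hex : fl t = t
      · -- (ii) exact step: the error is unchanged and lies below the common quantum of `Q`, `a`
        refine ⟨min s₀ v, by rw [hex]; exact htg, ?_⟩
        rw [hsplit, hex, sub_self, zero_add]; exact hEg
      · -- (iii) the grid step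
        obtain ⟨s, hs, hδ⟩ := hflj t
        rw [abs_sub_comm] at hδ
        refine ⟨s, hs, ?_⟩
        rw [hsplit]
        exact two_pow_mul_abs_add_lt_of_onGrid hs htg (sub_ne_zero.mpr hex) hδ hEg
    -- conjunct 3: magnitudes
    have hMag : ∀ b : ℤ, (∀ x ∈ l ++ [a], |x| < (2 : ℚ) ^ b) →
        |fl t| ≤ (2 : ℚ) ^ b ∧ |fl t - (l.sum + a)| < (2 : ℚ) ^ (b - p) := by
      intro b hb
      have hab : |a| < (2 : ℚ) ^ b := hb a (by simp)
      have hva : (2 : ℚ) ^ v ≤ |a| := haG.two_zpow_le_abs ha0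
      have hvb : v < b := by
        by_contra hle
        rw [not_lt] at hle
        have : (2 : ℚ) ^ b ≤ (2 : ℚ) ^ v := zpow_le_zpow_right₀ (by norm_num) hle
        linarith
      -- `|a| ≤ 2^b − 2^v` (both on the grid `2^v`), so `|Q + a| ≤ 2^b`
      have hle_a : |a| + (2 : ℚ) ^ v ≤ (2 : ℚ) ^ b :=
        haG.abs.add_two_zpow_le (OnGrid.two_zpow hvb.le) hab
      have ht_le : |t| ≤ (2 : ℚ) ^ b := by
        calc |t| = |Q + a| := by rw [htdef]
          _ ≤ |Q| + |a| := abs_add_le _ _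
          _ ≤ (2 : ℚ) ^ b := by linarith
      refine ⟨abs_fl_le_of_abs_le hfl (isFloat_two_zpow hp (by omega)) ht_le, ?_⟩
      have htG : OnGrid emin t := by
        rw [htdef]; exact (OnGrid.of_isFloat hQF).add (OnGrid.of_isFloat hFa)
      have hround := two_mul_abs_fl_sub_le_of_onGrid hp hfl htG ht_le
      have hvp : (2 : ℚ) ^ (v - p) ≤ (2 : ℚ) ^ (b - p) / 2 := by
        rw [le_div_iff₀ (by norm_num : (0 : ℚ) < 2), ← zpow_add_one₀ h2ne]
        exact zpow_le_zpow_right₀ (by norm_num) (by omega)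
      rw [hsplit]
      calc |fl t - t + (Q - l.sum)| ≤ |fl t - t| + |Q - l.sum| := abs_add_le _ _
        _ < (2 : ℚ) ^ (b - p) := by linarith
    exact ⟨(hfl t).1, hB, hMag⟩

/-! ## The theorems -/

/-- **`Q − Σ` LIES `2^j`-BELOW `Q`** for a round-to-nearest with `RoundoffBelow 2^j` (`j ≤ p`) on a
nonoverlapping expansion of floats. -/
theorem below_estimate_sub_sum (hp : 1 ≤ p) (hfl : IsRoundNearest p emin fl) {j : ℕ}
    (hjp : j ≤ p) (hflj : RoundoffBelow ((2 : ℚ) ^ j) fl) {l : List ℚ}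
    (hF : ∀ x ∈ l, IsFloat p emin x) (hE : IsExpansion 1 l) :
    Below ((2 : ℚ) ^ j) (estimate fl l - l.sum) (estimate fl l) :=
  (estimate_lastBit_invariant hp hfl hjp hflj hF hE).2.1

/-- **ANY ROUND-TO-NEAREST: THE WORD AND ITS ERROR ARE NONOVERLAPPING** — `estimate l − Σ l` lies
1-below `estimate l` (`p ≥ 1`, any tie rule, gradual underflow included). -/
theorem below_one_estimate_sub_sum (hp : 1 ≤ p) (hfl : IsRoundNearest p emin fl) {l : List ℚ}
    (hF : ∀ x ∈ l, IsFloat p emin x) (hE : IsExpansion 1 l) :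
    Below 1 (estimate fl l - l.sum) (estimate fl l) := by
  simpa using below_estimate_sub_sum hp hfl (Nat.zero_le p)
    (by simpa using roundoffBelow_one hp hfl) hF hE

/-- Dictionary form: `estimate l − Σ l` and `estimate l` are nonoverlapping in Shewchuk's sense. -/
theorem nonoverlapping_estimate_sub_sum (hp : 1 ≤ p) (hfl : IsRoundNearest p emin fl)
    {l : List ℚ} (hF : ∀ x ∈ l, IsFloat p emin x) (hE : IsExpansion 1 l) :
    Nonoverlapping (estimate fl l - l.sum) (estimate fl l) :=
  (below_one_estimate_sub_sum hp hfl hF hE).nonoverlapping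

/-- **ANY ROUND-TO-NEAREST, LAST-BIT FORM: `|Q − Σ| < 2^v`** where `2^v` is the least significant
nonzero bit of `Q = estimate l = M·2^v` (`M` odd). -/
theorem abs_estimate_sub_sum_lt_lowbit (hp : 1 ≤ p) (hfl : IsRoundNearest p emin fl)
    {l : List ℚ} (hF : ∀ x ∈ l, IsFloat p emin x) (hE : IsExpansion 1 l) {M v : ℤ}
    (hM : Odd M) (hQ : estimate fl l = (M : ℚ) * (2 : ℚ) ^ v) :
    |estimate fl l - l.sum| < (2 : ℚ) ^ v := by
  obtain ⟨s, hs, hlt⟩ := below_one_estimate_sub_sum hp hfl hF hE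
  rw [one_mul] at hlt
  rw [hQ] at hs
  exact lt_of_lt_of_le hlt (zpow_le_zpow_right₀ (by norm_num) (OnGrid.le_of_odd hM hs))

/-- **ROUND-TO-EVEN: THE WORD AND ITS ERROR ARE NONADJACENT** — `estimate l − Σ l` lies 2-below
`estimate l` (`p ≥ 1`, gradual underflow included). -/
theorem below_two_estimate_sub_sum_roundTiesEven (hp : 1 ≤ p) {l : List ℚ}
    (hF : ∀ x ∈ l, IsFloat p emin x) (hE : IsExpansion 1 l) :
    Below 2 (estimate (roundTiesEven p emin) l - l.sum) (estimate (roundTiesEven p emin) l) := by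
  simpa using below_estimate_sub_sum hp (isRoundNearest_roundTiesEven hp) hp
    (by simpa using roundoffBelow_two_roundTiesEven p emin) hF hE

/-- Dictionary form: under round-to-even `estimate l − Σ l` and `estimate l` are nonadjacent. -/
theorem nonadjacent_estimate_sub_sum_roundTiesEven (hp : 1 ≤ p) {l : List ℚ}
    (hF : ∀ x ∈ l, IsFloat p emin x) (hE : IsExpansion 1 l) :
    Nonadjacent (estimate (roundTiesEven p emin) l - l.sum) (estimate (roundTiesEven p emin) l) :=
  (below_two_estimate_sub_sum_roundTiesEven hp hF hE).nonadjacent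

/-- **ROUND-TO-EVEN, LAST-BIT FORM: `|Q − Σ| < 2^v / 2`** where `2^v` is the least significant
nonzero bit of `Q = estimate l = M·2^v` (`M` odd). -/
theorem two_mul_abs_estimate_sub_sum_lt_lowbit_roundTiesEven (hp : 1 ≤ p) {l : List ℚ}
    (hF : ∀ x ∈ l, IsFloat p emin x) (hE : IsExpansion 1 l) {M v : ℤ} (hM : Odd M)
    (hQ : estimate (roundTiesEven p emin) l = (M : ℚ) * (2 : ℚ) ^ v) :
    2 * |estimate (roundTiesEven p emin) l - l.sum| < (2 : ℚ) ^ v := by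
  obtain ⟨s, hs, hlt⟩ := below_two_estimate_sub_sum_roundTiesEven hp hF hE
  rw [hQ] at hs
  exact lt_of_lt_of_le hlt (zpow_le_zpow_right₀ (by norm_num) (OnGrid.le_of_odd hM hs))

/-- **ROUND-TO-EVEN: `Q` IS THE POINT OF ITS OWN QUANTUM GRID NEAREST TO THE TRUE SUM** — every
other point `G` of `2^v·ℤ` (`2^v` the last nonzero bit of `Q = estimate l`) is strictly farther
from `Σ l` than `Q`. -/
theorem estimate_nearest_on_own_grid (hp : 1 ≤ p) {l : List ℚ}
    (hF : ∀ x ∈ l, IsFloat p emin x) (hE : IsExpansion 1 l) {M v : ℤ} (hM : Odd M)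
    (hQ : estimate (roundTiesEven p emin) l = (M : ℚ) * (2 : ℚ) ^ v) {G : ℚ} (hG : OnGrid v G)
    (hne : G ≠ estimate (roundTiesEven p emin) l) :
    |estimate (roundTiesEven p emin) l - l.sum| < |G - l.sum| := by
  have h2 := two_mul_abs_estimate_sub_sum_lt_lowbit_roundTiesEven hp hF hE hM hQ
  set Q := estimate (roundTiesEven p emin) l with hQdef
  have hgap : (2 : ℚ) ^ v ≤ |G - Q| :=
    (hG.sub (show OnGrid v Q from ⟨M, hQ⟩)).two_zpow_le_abs (sub_ne_zero.mpr hne)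
  have htri : |G - Q| ≤ |G - l.sum| + |l.sum - Q| := abs_sub_le _ _ _
  rw [abs_sub_comm l.sum Q] at htri
  linarith

/-! ## The factor two needs the tie rule -/

/-- **THE ROUND-TO-EVEN FACTOR TWO IS A PROPERTY OF THE TIE RULE**, not of nearest rounding: the
rounding of `F(2, 0)` that resolves the midpoint `7` toward zero (`7 ↦ 6`; no float of `F(2, 0)`
is closer — the floats near `7` are `4, 6, 8, 12`) and every other argument by round-to-even is a
round-to-nearest for which the nonoverlapping expansion `[1, 6]` has `estimate = 6 = 3·2^1`,
`Σ = 7`: the error `2^v/2` does not lie 2-below the word. -/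
theorem exists_isRoundNearest_not_below_two :
    ∃ fl : ℚ → ℚ, IsRoundNearest 2 0 fl ∧
      (∀ x ∈ [(1 : ℚ), 6], IsFloat 2 0 x) ∧ IsExpansion 1 [(1 : ℚ), 6] ∧
      estimate fl [1, 6] = 6 ∧ [(1 : ℚ), 6].sum = 7 ∧
      ¬ Below 2 (estimate fl [1, 6] - [(1 : ℚ), 6].sum) (estimate fl [1, 6]) := by
  set fl : ℚ → ℚ := fun t => if t = 7 then 6 else roundTiesEven 2 0 t with hfl
  have h7 : fl 7 = 6 := by simp [hfl]
  have hQ : estimate fl [1, 6] = 6 := by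
    rw [show estimate fl [1, 6] = fl (1 + 6) from rfl, show (1 : ℚ) + 6 = 7 by norm_num, h7]
  have hRN : IsRoundNearest 2 0 fl := by
    intro t
    by_cases ht : t = 7
    · subst ht
      rw [h7]
      refine ⟨⟨3, 1, by norm_num, by norm_num, by norm_num⟩, fun f hf => ?_⟩
      obtain ⟨N, e, hN, he, rfl⟩ := hf
      obtain ⟨n, rfl⟩ := Int.eq_ofNat_of_zero_le he
      rw [zpow_natCast, show |(7 : ℚ) - 6| = 1 by norm_num]
      -- `7 − N·2^n` is a nonzero integer: `|N| ≤ 3` when `n = 0`, even otherwise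
      have hint : (7 : ℤ) - N * 2 ^ n ≠ 0 := by
        rcases n with _ | n
        · norm_num at hN
          have := abs_lt.mp hN
          simp only [pow_zero, mul_one]
          omega
        · rw [pow_succ, ← mul_assoc]
          generalize N * 2 ^ n = K
          omega
      have h1 : (((1 : ℤ)) : ℚ) ≤ (((|(7 : ℤ) - N * 2 ^ n|) : ℤ) : ℚ) := by
        exact_mod_cast Int.one_le_abs hint
      rw [Int.cast_abs] at h1
      push_cast at h1
      exact h1
    · rw [show fl t = roundTiesEven 2 0 t by simp [hfl, ht]]
      exact isRoundNearest_roundTiesEven (p := 2) (emin := 0) (by norm_num) t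
  refine ⟨fl, hRN, ?_, List.pairwise_pair.mpr ⟨1, ⟨3, by norm_num⟩, by norm_num⟩, hQ,
    by norm_num, ?_⟩
  · intro x hx
    simp only [List.mem_cons, List.mem_nil_iff, or_false] at hx
    rcases hx with rfl | rfl
    · exact ⟨1, 0, by norm_num, le_rfl, by norm_num⟩
    · exact ⟨3, 1, by norm_num, by norm_num, by norm_num⟩
  · rintro ⟨s, hs, hlt⟩
    rw [hQ] at hs hlt
    norm_num at hlt
    have hs1 : s ≤ 1 :=
      OnGrid.le_of_odd (M := 3) (v := 1) ⟨1, by norm_num⟩ (by norm_num; exact hs)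
    have : (2 : ℚ) ^ s ≤ (2 : ℚ) ^ (1 : ℤ) := zpow_le_zpow_right₀ (by norm_num) hs1
    norm_num at this
    linarith

end Summit.Ventures.CertifiedArithmetic.Expansions
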